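import Literature.Geometry.Lorentzian.HypersurfaceHessian
import Literature.Geometry.Lorentzian.TracedGaussEquation
import Literature.Geometry.Lorentzian.SuperharmonicFactor
import Literature.Geometry.Lorentzian.EnergyCurrents
import HarnessLib

/-!
# The mean curvature of a hypersurface contained in a level set:
# `H · dφ(ν)/ε = Δ_g φ − Hess_g φ(ν, ν)/ε`

Let `f : (N², f^*g) → (M³, g)` be a spacelike immersion of a surface into a pseudo-Riemannian
`3`-manifold, with unit normal field `ν` of sign `ε` (smooth lift), second fundamental form
`K(v, w) = g(D_v ν, df w)` and mean curvature `H = tr_{f^*g} K` (`Hypersurface.lean`). We prove: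

* `trace_eq_trace_inducedMetric_add_div` — **the tangent–normal split of the metric trace**: for a
  bilinear form `B` on `T_{f y} M`,
  `tr_g B = tr_{f^*g} (B ∘ (df × df)) + B(ν, ν)/ε` (an orthogonal basis of `T_y N` pushed forward,
  together with `ν`, is an orthogonal basis of `T_{f y} M`; O'Neill 1983, Ch. 3, pp. 60–61 and
  Ch. 4, pp. 97–100);
* `mvfderiv_mfderiv_eq_zero_of_comp_eventuallyEq`, `gradSq_eq_sq_div_of_comp_eventuallyEq` — if
  `φ ∘ f` is constant near `y` (the hypersurface lies in a level set of `φ` near `f y`) then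
  `dφ ∘ df_y = 0` and `g⁻¹(dφ, dφ)(f y) = dφ(ν_y)²/ε` (`grad φ` is normal);
* `trace_hessian_comp_eq_of_comp_eventuallyEq` — **`tr_{f^*g}(Hess_g φ ∘ (df × df))(y) =
  (dφ(ν)/ε) H(y)`** when `φ ∘ f` is constant near `y` (the Laplacian of the restriction,
  `dalembertian_comp_eq`: `Δ_{f^*g}(φ ∘ f) = tr_{f^*g}(Hess φ ∘ (df × df)) − (dφ(ν)/ε) H`,
  applied to a locally constant restriction);
* `meanCurvature_mul_eq_dalembertian_sub_of_comp_eventuallyEq` — **the level-set formula**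
  `(dφ(ν)/ε) H(y) = Δ_g φ(f y) − Hess_g φ(ν, ν)(f y)/ε`; for a Riemannian `g` (`ε = 1`,
  `dφ(ν) = ±|∇φ|`, `ν = ±grad φ/|∇φ|`) this is the classical
  `H = ± (Δφ − Hess φ(∇φ, ∇φ)/|∇φ|²)/|∇φ| = ± div(∇φ/|∇φ|)` for the level sets of `φ`
  (Huisken–Ilmanen 2001, §1, Level-Set Description, (∗∗): "`div_M(∇u/|∇u|)` gives the mean
  curvature of `{u = t}`"), derived here from O'Neill's Lemma 4.3/4.4 via
  `HypersurfaceHessian.lean`.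

Purpose (Schoen–Yau 1979, §2, Step 2 and Appendix, p. 75): the Plateau solutions `S_σ` are kept in
the interior by boundaries of positive mean curvature; on a boundaryless asymptotically flat
manifold this role is played by large coordinate spheres `{r = Λ}`, whose mean curvature
`H = (Δ_g r − Hess_g r(n, n))/|∇r| = 2/Λ + O(Λ⁻²) > 0` is computed from this formula and the
asymptotics of the end. Everything is proved; no definitions, no named facts.

## References

* B. O'Neill, *Semi-Riemannian geometry with applications to relativity*, Academic Press 1983,
  Ch. 3, pp. 60–61 (metric contraction), Def. 3.50; Ch. 4, pp. 97–100 and 106–107 (tangent and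
  normal parts, hypersurfaces of sign `ε`), Lemma 4.3–4.4. [ONeill1983]
* G. Huisken, T. Ilmanen, *The inverse mean curvature flow and the Riemannian Penrose
  inequality*, J. Differential Geom. 59 (2001) 353–437, §1, Level-Set Description, (∗∗), p. 362
  (PDF p. 12: the mean curvature of the level sets `{u = t}` is `div_M(∇u/|∇u|)`).
  [HuiskenIlmanenIMCF2001]
* R. Schoen, S.-T. Yau, *On the proof of the positive mass conjecture in general relativity*,
  Comm. Math. Phys. 65 (1979) 45–76, Appendix, p. 75 (boundaries of positive mean curvature as
  barriers for the Plateau solutions). [SchoenYauPMT1979]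
-/

noncomputable section

open Bundle Set Filter Function Manifold FiberBundle Module
open scoped Manifold ContDiff Topology

namespace Literature.Geometry.Lorentzian

namespace PseudoRiemannianMetric

variable {E : Type*} [NormedAddCommGroup E] [NormedSpace ℝ E] {H : Type*} [TopologicalSpace H]
  {I : ModelWithCorners ℝ E H} {M : Type*} [TopologicalSpace M] [ChartedSpace H M]
  [IsManifold I ∞ M] [FiniteDimensional ℝ E] [CompleteSpace E] [I.Boundaryless]
  (g : PseudoRiemannianMetric I ∞ E (TangentSpace I : M → Type _)) [g.HasLeviCivita]

section Restricted

variable {E' : Type*} [NormedAddCommGroup E'] [NormedSpace ℝ E'] {H' : Type*} [TopologicalSpace H']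
  {I' : ModelWithCorners ℝ E' H'} {N : Type*} [TopologicalSpace N] [ChartedSpace H' N]
  [IsManifold I' ∞ N] [FiniteDimensional ℝ E'] [CompleteSpace E'] [I'.Boundaryless] {f : N → M}
  (hpb : PseudoRiemannianMetric.contMDiff_pullbackBilin I M I' N ∞)
  (hfi : g.IsSpacelikeImmersion I' f) {ν : NormalField I f} {ε : ℝ}

/-! ### The tangent–normal split of the metric trace -/

omit [CompleteSpace E] [g.HasLeviCivita] [IsManifold I' ∞ N] [CompleteSpace E']
  [I'.Boundaryless] [I.Boundaryless] in
/-- A double sum against a diagonal matrix collapses to the diagonal. [folklore] -/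
private theorem sum_sum_diagonal_mul_levelSet {ι : Type*} [Fintype ι] [DecidableEq ι] (d : ι → ℝ)
    (T : ι → ι → ℝ) : ∑ i, ∑ j, Matrix.diagonal d j i * T i j = ∑ i, d i * T i i := by
  refine Finset.sum_congr rfl fun i _ ↦ ?_
  rw [Finset.sum_eq_single i]
  · rw [Matrix.diagonal_apply_eq]
  · intro j _ hji
    rw [Matrix.diagonal_apply_ne _ hji, zero_mul]
  · intro hi
    exact absurd (Finset.mem_univ i) hi

omit [CompleteSpace E] [g.HasLeviCivita] [CompleteSpace E'] [I'.Boundaryless] [I.Boundaryless] in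
/-- **The tangent–normal split of the metric trace on an immersed surface in a `3`-manifold.**
For a spacelike immersion `f : (N², f^*g) → (M³, g)` with a unit normal `ν` of sign `ε ≠ 0` and a
bilinear form `B` on `T_{f y} M`:

  `tr_g B = tr_{f^*g} (B ∘ (df_y × df_y)) + B(ν_y, ν_y) / ε`.

Proof: an `f^*g`-orthogonal basis `(β₀, β₁)` of `T_y N` gives the `g`-orthogonal basis
`(df β₀, df β₁, ν)` of `T_{f y} M` (a dimension count), in which both traces are diagonal sums
(`trace_eq_sum_gram_inv`, `gram_inv_of_isOrthoᵢ`). O'Neill 1983, Ch. 3, pp. 60–61 (metric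
contraction in a frame) and Ch. 4, pp. 97–100 (`T_p M̄ = T_p M ⊕ T_p M^⊥`).
[cite: ONeill1983, Ch. 4, pp. 97–100] -/
theorem trace_eq_trace_inducedMetric_add_div (hun : g.IsUnitNormal I' f ν ε) (hε : ε ≠ 0)
    (h2 : finrank ℝ E' = 2) (h3 : finrank ℝ E = 3) (y₀ : N)
    (B : LinearMap.BilinForm ℝ (TangentSpace I (f y₀))) :
    g.trace (f y₀) B =
      (g.inducedMetric f hpb hfi).trace y₀
          (B.comp (mfderiv I' I f y₀).toLinearMap (mfderiv I' I f y₀).toLinearMap) +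
        B (ν y₀) (ν y₀) / ε := by
  classical
  -- an orthogonal basis `β` of `(T_{y₀} N, f^*g)`
  obtain ⟨e, he, hd⟩ := exists_isOrthoᵢ_basis (g.inducedMetric f hpb hfi) y₀
  have hfin : finrank ℝ (TangentSpace I' y₀) = 2 := h2
  set β : Module.Basis (Fin 2) ℝ (TangentSpace I' y₀) := e.reindex (finCongr hfin) with hβdef
  have hβapply : ∀ k, β k = e ((finCongr hfin).symm k) := fun k ↦ Module.Basis.reindex_apply _ _ _
  have hβ : ((g.inducedMetric f hpb hfi).toBilinForm y₀).IsOrthoᵢ β := by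
    intro k l hkl
    simp only [Function.onFun, hβapply]
    exact he fun h ↦ hkl ((finCongr hfin).symm.injective h)
  have hdβ : ∀ k, (g.inducedMetric f hpb hfi).val y₀ (β k) (β k) ≠ 0 := fun k ↦ by
    rw [hβapply]; exact hd _
  -- the adapted orthogonal basis `(df β₀, df β₁, ν)` of `T_{f y₀} M`
  have hn0 : ∀ k, g.val (f y₀) (mfderiv I' I f y₀ (β k)) (ν y₀) = 0 := fun k ↦ by
    rw [g.symm]; exact hun.1 y₀ (β k)
  have h01 : g.val (f y₀) (mfderiv I' I f y₀ (β 0)) (mfderiv I' I f y₀ (β 1)) = 0 :=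
    hβ (show (0 : Fin 2) ≠ 1 by decide)
  have h10 : g.val (f y₀) (mfderiv I' I f y₀ (β 1)) (mfderiv I' I f y₀ (β 0)) = 0 :=
    hβ (show (1 : Fin 2) ≠ 0 by decide)
  have hνε : g.val (f y₀) (ν y₀) (ν y₀) = ε := hun.2 y₀
  set v : Fin 3 → TangentSpace I (f y₀) :=
    ![mfderiv I' I f y₀ (β 0), mfderiv I' I f y₀ (β 1), ν y₀] with hv
  have hv0 : v 0 = mfderiv I' I f y₀ (β 0) := rfl
  have hv1 : v 1 = mfderiv I' I f y₀ (β 1) := rfl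
  have hv2 : v 2 = ν y₀ := rfl
  have hvo : (g.toBilinForm (f y₀)).IsOrthoᵢ v := by
    intro k l hkl
    fin_cases k <;> fin_cases l <;> first
      | exact absurd rfl hkl
      | simp only [Function.onFun, hv0, hv1, hv2, Fin.zero_eta, Fin.mk_one, Fin.reduceFinMk,
          toBilinForm_apply, h01, h10, hn0, g.symm (f y₀) (ν y₀) (mfderiv I' I f y₀ (β _))]
  have hvd : ∀ k, g.toBilinForm (f y₀) (v k) (v k) ≠ 0 := by
    intro k
    fin_cases k
    · simpa [hv0, toBilinForm_apply] using hdβ 0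
    · simpa [hv1, toBilinForm_apply] using hdβ 1
    · simp only [hv2, Fin.reduceFinMk, toBilinForm_apply, hνε]; exact hε
  have hli : LinearIndependent ℝ v := LinearMap.linearIndependent_of_isOrthoᵢ hvo hvd
  haveI : FiniteDimensional ℝ (TangentSpace I (f y₀)) := inferInstanceAs (FiniteDimensional ℝ E)
  have hcard : Fintype.card (Fin 3) = finrank ℝ (TangentSpace I (f y₀)) := by
    show Fintype.card (Fin 3) = finrank ℝ E
    rw [h3, Fintype.card_fin]
  set γ := basisOfLinearIndependentOfCardEqFinrank hli hcard with hγdef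
  have hγ : ∀ k, γ k = v k := fun k ↦
    congrFun (coe_basisOfLinearIndependentOfCardEqFinrank hli hcard) k
  have hγo : (g.toBilinForm (f y₀)).IsOrthoᵢ γ := by
    intro k l hkl
    simp only [Function.onFun, hγ]
    exact hvo hkl
  have hγd : ∀ k, g.val (f y₀) (γ k) (γ k) ≠ 0 := fun k ↦ by
    rw [hγ]; exact hvd k
  -- both traces in the orthogonal bases
  rw [trace_eq_sum_gram_inv g (f y₀) γ B, gram_inv_of_isOrthoᵢ g (f y₀) γ hγo hγd,
    sum_sum_diagonal_mul_levelSet, trace_eq_sum_gram_inv (g.inducedMetric f hpb hfi) y₀ β,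
    gram_inv_of_isOrthoᵢ (g.inducedMetric f hpb hfi) y₀ β hβ hdβ, sum_sum_diagonal_mul_levelSet]
  simp only [Fin.sum_univ_three, Fin.sum_univ_two, hγ, hv0, hv1, hv2, hνε,
    LinearMap.BilinForm.comp_apply, ContinuousLinearMap.coe_coe]
  have ha : ∀ k, g.val (f y₀) (mfderiv I' I f y₀ (β k)) (mfderiv I' I f y₀ (β k)) =
      (g.inducedMetric f hpb hfi).val y₀ (β k) (β k) := fun k ↦ rfl
  rw [ha 0, ha 1, div_eq_inv_mul]

/-! ### Hypersurfaces in a level set -/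

omit [CompleteSpace E] [g.HasLeviCivita] [FiniteDimensional ℝ E] [FiniteDimensional ℝ E']
  [CompleteSpace E'] [I'.Boundaryless] [I.Boundaryless] [IsManifold I ∞ M] [IsManifold I' ∞ N] in
/-- **A hypersurface contained in a level set is tangent to it**: if `φ ∘ f` is constant near `y`
with `φ` and `f` differentiable, then `dφ_{f y}(df_y v) = 0` for every `v` (chain rule).
[folklore] -/
theorem mvfderiv_mfderiv_eq_zero_of_comp_eventuallyEq {φ : M → ℝ} {y : N} {c : ℝ}
    (hφ : MDifferentiableAt I 𝓘(ℝ, ℝ) φ (f y)) (hf : MDifferentiableAt I' I f y)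
    (hc : (fun z ↦ φ (f z)) =ᶠ[𝓝 y] fun _ ↦ c) (v : TangentSpace I' y) :
    mvfderiv I φ (f y) (mfderiv I' I f y v) = 0 := by
  have hcomp : mfderiv I' 𝓘(ℝ, ℝ) (φ ∘ f) y = (mfderiv I 𝓘(ℝ, ℝ) φ (f y)).comp (mfderiv I' I f y) :=
    mfderiv_comp y hφ hf
  have h0 : mfderiv I' 𝓘(ℝ, ℝ) (φ ∘ f) y = 0 := by
    have hc' : (φ ∘ f) =ᶠ[𝓝 y] fun _ ↦ c := hc
    rw [hc'.mfderiv_eq]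
    exact mfderiv_const
  have h1 : ((mfderiv I 𝓘(ℝ, ℝ) φ (f y)).comp (mfderiv I' I f y)) v = 0 := by
    rw [← hcomp, h0]
    rfl
  exact h1

omit [CompleteSpace E] [g.HasLeviCivita] [CompleteSpace E'] [I'.Boundaryless] [I.Boundaryless] in
include hpb hfi in
/-- **The gradient of `φ` is normal along a hypersurface in a level set**: if `φ ∘ f` is constant
near `y`, then `grad φ(f y) = (dφ(ν_y)/ε) ν_y` for a unit normal `ν` of sign `ε ≠ 0` of the
hypersurface `f` (`dim M = dim N + 1`): `grad φ` pairs to zero with `df(T_y N)`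
(`mvfderiv_mfderiv_eq_zero_of_comp_eventuallyEq`), so only its normal component survives in the
decomposition `T_{f y} M = df(T_y N) ⊕ ℝν` (`val_eq_inducedMetric_add_normal`). O'Neill 1983,
Ch. 4, pp. 97–100. [cite: ONeill1983, Ch. 4, pp. 97–100] -/
theorem sharp_mvfderiv_eq_smul_normal_of_comp_eventuallyEq (hun : g.IsUnitNormal I' f ν ε)
    (hε : ε ≠ 0) (hdim : finrank ℝ E = finrank ℝ E' + 1) {φ : M → ℝ} {y : N} {c : ℝ}
    (hφ : MDifferentiableAt I 𝓘(ℝ, ℝ) φ (f y))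
    (hc : (fun z ↦ φ (f z)) =ᶠ[𝓝 y] fun _ ↦ c) :
    (g.sharp (f y) (mvfderiv I φ (f y)).toLinearMap : TangentSpace I (f y)) =
      (mvfderiv I φ (f y) (ν y) / ε) • ν y := by
  set A : TangentSpace I (f y) := g.sharp (f y) (mvfderiv I φ (f y)).toLinearMap with hA
  have hf : MDifferentiableAt I' I f y := (hfi.contMDiff_self y).mdifferentiableAt (by simp)
  have htan : ∀ u : TangentSpace I' y, g.val (f y) A (mfderiv I' I f y u) =
      (g.inducedMetric f hpb hfi).val y 0 u := fun u ↦ by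
    simp only [hA, val_sharp_apply, ContinuousLinearMap.coe_coe, map_zero]
    exact mvfderiv_mfderiv_eq_zero_of_comp_eventuallyEq hφ hf hc u
  have hAν : g.val (f y) A (ν y) = mvfderiv I φ (f y) (ν y) := by
    simp only [hA, val_sharp_apply, ContinuousLinearMap.coe_coe]
  -- pair `A − (g(A,ν)/ε) ν` with an arbitrary `B`, decomposed into tangential and normal parts
  have horth : ∀ B : TangentSpace I (f y),
      g.val (f y) (A - (mvfderiv I φ (f y) (ν y) / ε) • ν y) B = 0 := by
    intro B
    -- the tangential component `b` of `B`: `(f^*g)(b, u) = g(B, df u)` for all `u`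
    set ℓ : Module.Dual ℝ (TangentSpace I' y) :=
      (g.val (f y) B).toLinearMap.comp (mfderiv I' I f y).toLinearMap with hℓ
    set b : TangentSpace I' y := (g.inducedMetric f hpb hfi).sharp y ℓ with hb
    have hB : ∀ u : TangentSpace I' y, g.val (f y) B (mfderiv I' I f y u) =
        (g.inducedMetric f hpb hfi).val y b u := fun u ↦ by
      rw [hb, val_sharp_apply]
      rfl
    have hdec := val_eq_inducedMetric_add_normal g hpb hfi (y := y) (νy := ν y) (A := A) (B := B)
      (a := 0) (b := b) (ε := ε) (hun.1 y) (hun.2 y) hε hdim htan hB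
    rw [map_sub, map_smul, _root_.sub_apply, _root_.smul_apply, hdec, hAν, smul_eq_mul,
      map_zero, _root_.zero_apply, zero_add, g.symm (f y) (ν y) B]
    ring
  have h0 := g.nondegenerate (f y) _ horth
  rw [sub_eq_zero] at h0
  exact h0

omit [CompleteSpace E] [g.HasLeviCivita] [CompleteSpace E'] [I'.Boundaryless] [I.Boundaryless] in
include hpb hfi in
/-- **`g⁻¹(dφ, dφ) = dφ(ν)²/ε` along a hypersurface in a level set of `φ`** (the gradient is
`(dφ(ν)/ε) ν`, `sharp_mvfderiv_eq_smul_normal_of_comp_eventuallyEq`, and `g(ν, ν) = ε`). For a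
Riemannian metric (`ε = 1`): `|∇φ|² = dφ(ν)²`, i.e. `dφ(ν) = ±|∇φ|`.
[cite: ONeill1983, Ch. 4, pp. 97–100] -/
theorem gradSq_eq_sq_div_of_comp_eventuallyEq (hun : g.IsUnitNormal I' f ν ε) (hε : ε ≠ 0)
    (hdim : finrank ℝ E = finrank ℝ E' + 1) {φ : M → ℝ} {y : N} {c : ℝ}
    (hφ : MDifferentiableAt I 𝓘(ℝ, ℝ) φ (f y))
    (hc : (fun z ↦ φ (f z)) =ᶠ[𝓝 y] fun _ ↦ c) :
    g.gradSq φ (f y) = (mvfderiv I φ (f y) (ν y)) ^ 2 / ε := by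
  have hG := g.sharp_mvfderiv_eq_smul_normal_of_comp_eventuallyEq hpb hfi hun hε hdim hφ hc
  rw [gradSq, innerDual_eq_val_sharp_sharp]
  change g.val (f y) (g.sharp (f y) (mvfderiv I φ (f y)).toLinearMap)
    (g.sharp (f y) (mvfderiv I φ (f y)).toLinearMap) = _
  rw [hG]
  simp only [map_smul, _root_.smul_apply, smul_eq_mul, hun.2 y]
  field_simp

/-- **The trace of the restricted Hessian on a hypersurface in a level set**: if `φ ∈ C²(M)` and
`φ ∘ f` is constant near `y₀`, then
`tr_{f^*g}(Hess_g φ ∘ (df × df))(y₀) = (dφ(ν)/ε) H(y₀)`, `H = tr K` the mean curvature for the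
unit normal `ν` of sign `ε` — the Laplacian of the (locally constant) restriction vanishes
(`dalembertian_eq_zero_of_eventuallyEq`, `SuperharmonicFactor.lean`) in `dalembertian_comp_eq`
(`Δ_{f^*g}(φ ∘ f) = tr(Hess φ ∘ (df × df)) − (dφ(ν)/ε) H`). O'Neill 1983, Ch. 4, Lemma 4.3–4.4 with
Ch. 3, Def. 3.50. [cite: ONeill1983, Ch. 4, Lemma 3 and Lemma 4] -/
theorem trace_hessian_comp_eq_of_comp_eventuallyEq
    (hν : ContMDiff I' I.tangent ∞ (fun x ↦ (TotalSpace.mk' E (f x) (ν x) : TangentBundle I M)))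
    (hun : g.IsUnitNormal I' f ν ε) (hε : ε ≠ 0) (hdim : finrank ℝ E = finrank ℝ E' + 1)
    {φ : M → ℝ} (hφ : CMDiff 2 φ) {y₀ : N} {c : ℝ}
    (hc : (fun z ↦ φ (f z)) =ᶠ[𝓝 y₀] fun _ ↦ c) :
    (g.inducedMetric f hpb hfi).trace y₀
        ((g.hessian φ (f y₀)).comp (mfderiv I' I f y₀).toLinearMap
          (mfderiv I' I f y₀).toLinearMap) =
      mvfderiv I φ (f y₀) (ν y₀) / ε * g.meanCurvature f hpb hfi ν y₀ := by
  haveI := (g.inducedMetric f hpb hfi).hasLeviCivita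
  have hΔ := g.dalembertian_comp_eq hpb hfi hν hun hε hdim hφ y₀
  have h0 : (g.inducedMetric f hpb hfi).dalembertian (fun y ↦ φ (f y)) y₀ = 0 :=
    (g.inducedMetric f hpb hfi).dalembertian_eq_zero_of_eventuallyEq hc
  rw [h0] at hΔ
  linarith

/-- **The mean curvature of a surface contained in a level set** (dimension `2 + 1`). Let
`f : (N², f^*g) → (M³, g)` be a spacelike immersion with smooth unit normal `ν` of sign `ε ≠ 0`,
`φ ∈ C²(M)`, and suppose `φ ∘ f` is constant near `y₀`. Then

  `(dφ(ν_{y₀})/ε) · H(y₀) = Δ_g φ(f y₀) − Hess_g φ(ν_{y₀}, ν_{y₀})/ε`.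

(`trace_hessian_comp_eq_of_comp_eventuallyEq` and the tangent–normal split of `Δ_g φ = tr_g Hess φ`,
`trace_eq_trace_inducedMetric_add_div`.) For `g` Riemannian, `ε = 1` and `dφ(ν) = ±|∇φ| ≠ 0`
(`gradSq_eq_sq_div_of_comp_eventuallyEq`), this is the classical mean curvature of the level sets
of `φ`, `H = ± (Δφ − Hess φ(∇φ,∇φ)/|∇φ|²)/|∇φ| = ± div(∇φ/|∇φ|)` (Huisken–Ilmanen 2001, §1,
Level-Set Description, (∗∗)), here obtained from O'Neill 1983, Ch. 4, Lemma 4.3–4.4.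
It is the formula by which large coordinate spheres of an asymptotically flat end are seen to be
mean-convex (Schoen–Yau 1979, Appendix, p. 75: boundaries of positive mean curvature confine the
Plateau solutions). [cite: ONeill1983, Ch. 4, Lemma 3 and Lemma 4]
[cite: HuiskenIlmanenIMCF2001, §1, Level-Set Description, (∗∗)] -/
theorem meanCurvature_mul_eq_dalembertian_sub_of_comp_eventuallyEq
    (hν : ContMDiff I' I.tangent ∞ (fun x ↦ (TotalSpace.mk' E (f x) (ν x) : TangentBundle I M)))
    (hun : g.IsUnitNormal I' f ν ε) (hε : ε ≠ 0) (h2 : finrank ℝ E' = 2) (h3 : finrank ℝ E = 3)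
    {φ : M → ℝ} (hφ : CMDiff 2 φ) {y₀ : N} {c : ℝ}
    (hc : (fun z ↦ φ (f z)) =ᶠ[𝓝 y₀] fun _ ↦ c) :
    mvfderiv I φ (f y₀) (ν y₀) / ε * g.meanCurvature f hpb hfi ν y₀ =
      g.dalembertian φ (f y₀) - g.hessian φ (f y₀) (ν y₀) (ν y₀) / ε := by
  have hdim : finrank ℝ E = finrank ℝ E' + 1 := by rw [h2, h3]
  rw [← g.trace_hessian_comp_eq_of_comp_eventuallyEq hpb hfi hν hun hε hdim hφ hc,
    PseudoRiemannianMetric.dalembertian,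
    g.trace_eq_trace_inducedMetric_add_div hpb hfi hun hε h2 h3 y₀ (g.hessian φ (f y₀))]
  ring

end Restricted

end PseudoRiemannianMetric

end Literature.Geometry.Lorentzian

end
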